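import Literature.Barriers.FinalStateConjecture.ExtremalHorizonChargeConservation
import Literature.Geometry.Lorentzian.KerrSchildDivergence
import Mathlib.Analysis.Calculus.FDeriv.Symmetric
import Mathlib.MeasureTheory.Integral.Prod
import Mathlib.Analysis.SpecialFunctions.Integrals.Basic
import HarnessLib

/-!
# Barrier catalogue `FinalStateConjecture`: proof of Aretakis's conservation law on the extremal
# Kerr horizon (`Aretakis2015_chargeConservation_holds`)

`ExtremalHorizonChargeConservation.lean` vendors as a named fact the conservation along `𝓗⁺` of
Aretakis's charge `H₀^{Kerr}[ψ](τ) = ∫_{S_τ} (M sin² θ · Tψ + 4M · Yψ + 2ψ)` for smooth solutions of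
`□_{g_{M,M}} ψ = 0` near `{r ≥ M} ∩ {t* ≥ 0}` in the extremal Kerr–Schild chart (Aretakis, ATMP 19
(2015), §5.2 and Prop. 5.1, `l = 0`). This file **proves** it, following the printed mechanism
(Prop. 3.1: restrict `□_g ψ` to the horizon, where the coefficient of `YYψ` vanishes by extremality,
and integrate the tangential derivatives away over the sphere):

* the horizon spheres `S_σ = {t* = σ} ∩ {r = M}` are parametrised by
  `Kerr.horizonPoint M σ θ φ = Kerr.extremalHorizonPoint M θ φ + σ ∂_{t*}`; along them the frame
  `T = ∂_{t*}`, `Y = ℓ♯ = (−1, sin θ cos φ, sin θ sin φ, cos θ)` (`Kerr.nullVector_horizonPoint`),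
  `Θ = ∂_θ` (`Kerr.thetaVec`), `Φ̂ = ∂_φ / sin θ` (`Kerr.phiHatVec`) is explicit, `Σ = M²(2 − sin² θ) = ρ²`
  and `H = M²/Σ`;
* **the inverse metric on the horizon in the adapted frame** (`Kerr.blSigma_mul_sum_inverseMetric_horizon`):
  `Σ g⁻¹ = M² sin² θ T⊗T + 2M² (T⊗Y + Y⊗T) + M sin θ (T⊗Φ̂ + Φ̂⊗T + Y⊗Φ̂ + Φ̂⊗Y) + Θ⊗Θ + Φ̂⊗Φ̂`, i.e.
  the printed components `g^{vv} = M² sin² θ/ρ²`, `g^{vr} = 2M²/ρ²`, `g^{vφ*} = g^{rφ*} = M/ρ²`,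
  `g^{θθ} = 1/ρ²`, `g^{φ*φ*} = 1/(ρ² sin² θ)`, `g^{rr} = g^{rθ} = g^{rφ} … = 0` at `r = M` (§5.2) — in
  particular **no `YY` term on the horizon** (`g^{rr} = Δ/ρ² = 0`);
* the first-order coefficients `Σ ∑_μ ∂_μ g^{μν} = −2M ℓ^ν` (`Kerr.divInverseMetric_eq`) and the
  vector identity `−2M sin θ (ℓ♯ + ∂_{t*}) = 2M sin θ ∂_φ ℓ♯ + ∂_φ Φ̂ + cos θ Θ + sin θ ∂_θ Θ`
  (`Kerr.horizon_firstOrder_identity`), which together say that on `𝓗⁺`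
  `sin θ · Σ □_g ψ = M sin θ · T(M sin² θ Tψ + 4M Yψ + 2ψ) + ∂_φ[2M sin θ (Tψ + Yψ) + Φ̂ψ] + ∂_θ[sin θ Θψ]`
  (`horizon_density_deriv_identity`; this is `ρ² □_g` of §5.2 restricted to `r = M`, with the
  coefficient of `TΦψ` equal to `2M/ρ² = 2g^{vφ*}` — the printed `2M²/ρ²` is a misprint);
* hence for a solution the `σ`-derivative of the charge density is a sum of a `θ`-total derivative
  vanishing at `θ = 0, π` and a `φ`-derivative of a `2π`-periodic function; by the fundamental theorem
  of calculus in `σ` and Fubini on `[0, τ] × [0, π] × [0, 2π]` the charge on `S_τ` equals the charge on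
  `S₀` (`Aretakis2015_chargeConservation_holds`);
* the bridge to the stationary flow, `H₀[ψ](τ) = H₀[ψ ∘ φ_τ](0)`
  (`aretakisChargeAt_eq_aretakisCharge_comp_timeTranslate`), the form in which the conservation law
  is consumed together with the time-translated solutions of `ExtremalHorizonInstabilityProofs.lean`.

Only real analysis from Mathlib is used (chain rule, symmetry of second derivatives, the fundamental
theorem of calculus, Fubini for continuous integrands on rectangles, continuity of parametric
interval integrals); the differential geometry enters through the coordinate formula
`Kerr.dalembertian_eq_divergence` for the prelude's abstract `dalembertian`.

## References

* S. Aretakis, *Horizon instability of extremal black holes*, Adv. Theor. Math. Phys. 19 (2015)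
  507–530 (arXiv:1206.6598): Prop. 3.1 (mechanism), §5.2 (metric, inverse metric, `□_g`, `H₀^{Kerr}`
  and its conservation), Prop. 5.1 (key `Aretakis2015`).
* R. P. Kerr, A. Schild, 1965, §2 (key `KerrSchild1965`); M. Visser, arXiv:0706.0622, (32)–(35)
  (key `arXiv07060622`).
-/

noncomputable section

open Set Filter MeasureTheory intervalIntegral
open scoped Topology ContDiff Manifold

namespace Literature.Barriers.FinalStateConjecture.Kerr

open Literature.Geometry.Lorentzian

/-! ### Derivatives of curves in `E4`, componentwise -/

/-- A curve in Euclidean space has a derivative iff each component has. [folklore] -/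
theorem hasDerivAt_euclidean {ι : Type*} [Fintype ι] {f : ℝ → EuclideanSpace ℝ ι}
    {f' : EuclideanSpace ℝ ι} {x : ℝ} :
    HasDerivAt f f' x ↔ ∀ i, HasDerivAt (fun t ↦ f t i) (f' i) x := by
  have h : ∀ i, (PiLp.proj 2 (fun _ : ι ↦ ℝ) i).comp (ContinuousLinearMap.toSpanSingleton ℝ f') =
      ContinuousLinearMap.toSpanSingleton ℝ (f' i) := by
    intro i; ext; simp
  simp only [hasDerivAt_iff_hasFDerivAt, ← hasFDerivWithinAt_univ, hasFDerivWithinAt_euclidean, h]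

/-- Derivative of an explicit curve `t ↦ (f₀ t, f₁ t, f₂ t, f₃ t)` in `E4`. [folklore] -/
theorem hasDerivAt_toLp_four {f₀ f₁ f₂ f₃ : ℝ → ℝ} {d₀ d₁ d₂ d₃ x : ℝ}
    (h₀ : HasDerivAt f₀ d₀ x) (h₁ : HasDerivAt f₁ d₁ x) (h₂ : HasDerivAt f₂ d₂ x)
    (h₃ : HasDerivAt f₃ d₃ x) :
    HasDerivAt (fun t ↦ (WithLp.toLp 2 ![f₀ t, f₁ t, f₂ t, f₃ t] : E4))
      (WithLp.toLp 2 ![d₀, d₁, d₂, d₃]) x := by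
  rw [hasDerivAt_euclidean]
  intro i
  fin_cases i
  · simpa using h₀
  · simpa using h₁
  · simpa using h₂
  · simpa using h₃

/-- Components of the coordinate basis vectors: `(∂_μ)^ν = δ_μ^ν`. [folklore] -/
@[simp]
theorem basisVector_apply (μ ν : Fin 4) : E4.basisVector μ ν = if ν = μ then 1 else 0 :=
  PiLp.single_apply _ _ _ _ _

/-! ### The horizon spheres `S_σ` in angular coordinates and the adapted frame -/

/-- The point of the horizon sphere `S_σ = {t* = σ} ∩ {r = M}` of extremal Kerr with angles
`(θ, φ*)`: `Kerr.extremalHorizonPoint M θ φ + σ ∂_{t*} = (σ, M sin θ (cos φ − sin φ),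
M sin θ (cos φ + sin φ), M cos θ)`. Aretakis, ATMP 19 (2015), §5.2 (`S_τ`, `𝓗⁺ = {r = M}`).
[cite: Aretakis2015, §5.2] -/
def horizonPoint (M σ θ φ : ℝ) : E4 :=
  extremalHorizonPoint M θ φ + σ • E4.basisVector 0

/-- Unfolding of `horizonPoint`. [cite: Aretakis2015, §5.2] -/
theorem horizonPoint_eq (M σ θ φ : ℝ) :
    horizonPoint M σ θ φ = extremalHorizonPoint M θ φ + σ • E4.basisVector 0 := rfl

/-- Components of the horizon point. [cite: Aretakis2015, §5.2] -/
theorem horizonPoint_eq_toLp (M σ θ φ : ℝ) :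
    horizonPoint M σ θ φ = WithLp.toLp 2 ![σ, M * Real.sin θ * (Real.cos φ - Real.sin φ),
      M * Real.sin θ * (Real.cos φ + Real.sin φ), M * Real.cos θ] := by
  ext i
  fin_cases i <;> simp [horizonPoint, extremalHorizonPoint]

/-- `t*` of the horizon point. [cite: Aretakis2015, §5.2] -/
@[simp] theorem horizonPoint_apply_zero (M σ θ φ : ℝ) : horizonPoint M σ θ φ 0 = σ := by
  simp [horizonPoint_eq_toLp]

/-- `x` of the horizon point. [cite: Aretakis2015, §5.2] -/
@[simp] theorem horizonPoint_apply_one (M σ θ φ : ℝ) :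
    horizonPoint M σ θ φ 1 = M * Real.sin θ * (Real.cos φ - Real.sin φ) := by
  simp [horizonPoint_eq_toLp]

/-- `y` of the horizon point. [cite: Aretakis2015, §5.2] -/
@[simp] theorem horizonPoint_apply_two (M σ θ φ : ℝ) :
    horizonPoint M σ θ φ 2 = M * Real.sin θ * (Real.cos φ + Real.sin φ) := by
  simp [horizonPoint_eq_toLp]

/-- `z` of the horizon point. [cite: Aretakis2015, §5.2] -/
@[simp] theorem horizonPoint_apply_three (M σ θ φ : ℝ) :
    horizonPoint M σ θ φ 3 = M * Real.cos θ := by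
  simp [horizonPoint_eq_toLp]

/-- The horizon point has Kerr–Schild radius `M` (for `M ≥ 0`). [cite: Aretakis2015, §5.2] -/
theorem radius_horizonPoint {M : ℝ} (hM : 0 ≤ M) (σ θ φ : ℝ) :
    Kerr.radius M (horizonPoint M σ θ φ) = M :=
  (radius_extremalHorizonPoint_add_smul hM θ φ σ).1

/-- `‖p⃗‖² = M²(1 + sin² θ)` on every horizon sphere. [cite: arXiv07060622, (35)] -/
theorem spatialNorm_sq_horizonPoint (M σ θ φ : ℝ) :
    E4.spatialNorm (horizonPoint M σ θ φ) ^ 2 = M ^ 2 * (1 + Real.sin θ ^ 2) := by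
  rw [E4.spatialNorm_sq, horizonPoint_apply_one, horizonPoint_apply_two, horizonPoint_apply_three]
  have h1 := Real.sin_sq_add_cos_sq θ
  have h2 := Real.sin_sq_add_cos_sq φ
  linear_combination (M ^ 2 * Real.sin θ ^ 2 * 2) * h2 + M ^ 2 * h1

/-- **`Σ = M² (2 − sin² θ) = ρ²` on the horizon** (`Σ = r² + a² cos² θ` at `r = a = M`).
[cite: Aretakis2015, §5.2] -/
theorem blSigma_horizonPoint {M : ℝ} (hM : 0 ≤ M) (σ θ φ : ℝ) :
    Kerr.blSigma M (E4.spatial (horizonPoint M σ θ φ)) = M ^ 2 * (2 - Real.sin θ ^ 2) := by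
  rw [Kerr.blSigma_spatial_eq, radius_horizonPoint hM, spatialNorm_sq_horizonPoint]
  ring

/-- For `M > 0` the horizon points lie in every chart `Kerr.region M r₀` with `r₀ < M`.
[cite: Aretakis2015, §5.2] -/
theorem horizonPoint_mem_region {M r₀ : ℝ} (hM : 0 < M) (hr₀ : r₀ < M) (σ θ φ : ℝ) :
    horizonPoint M σ θ φ ∈ Kerr.region M r₀ := by
  rw [Kerr.mem_region, radius_horizonPoint hM.le]
  exact max_lt hr₀ hM

/-- The transversal null vector on the horizon in angular coordinates:
`ℓ♯ = ∂_r = (−1, sin θ cos φ, sin θ sin φ, cos θ)` (as a function of the angles only).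
[cite: Aretakis2015, §5.2] -/
def horizonNull (θ φ : ℝ) : E4 :=
  WithLp.toLp 2 ![-1, Real.sin θ * Real.cos φ, Real.sin θ * Real.sin φ, Real.cos θ]

/-- **`ℓ♯` at the horizon points**: with `r = a = M`, `ℓ₁ = (x + y)/(2M) = sin θ cos φ`,
`ℓ₂ = (y − x)/(2M) = sin θ sin φ`, `ℓ₃ = z/M = cos θ`. [cite: arXiv07060622, (34)] -/
theorem nullVector_horizonPoint {M : ℝ} (hM : 0 < M) (σ θ φ : ℝ) :
    Kerr.nullVector M (horizonPoint M σ θ φ) = horizonNull θ φ := by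
  have hr := radius_horizonPoint hM.le σ θ φ
  have hM0 : M ≠ 0 := hM.ne'
  have hQ : M ^ 2 + M ^ 2 ≠ 0 := by positivity
  ext i
  fin_cases i
  · simp [horizonNull]
  · show Kerr.nullVector M (horizonPoint M σ θ φ) 1 = horizonNull θ φ 1
    rw [Kerr.nullVector_apply_one, Kerr.nullCovectorFun_apply_one, hr, horizonPoint_apply_one,
      horizonPoint_apply_two]
    simp only [horizonNull, PiLp.toLp_apply, Matrix.cons_val_one, Matrix.cons_val_zero]
    field_simp
    ring
  · show Kerr.nullVector M (horizonPoint M σ θ φ) 2 = horizonNull θ φ 2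
    rw [Kerr.nullVector_apply_two, Kerr.nullCovectorFun_apply_two, hr, horizonPoint_apply_one,
      horizonPoint_apply_two]
    simp only [horizonNull, PiLp.toLp_apply, Matrix.cons_val]
    field_simp
    ring
  · show Kerr.nullVector M (horizonPoint M σ θ φ) 3 = horizonNull θ φ 3
    rw [Kerr.nullVector_apply_three, Kerr.nullCovectorFun_apply_three, hr, horizonPoint_apply_three]
    simp only [horizonNull, PiLp.toLp_apply, Matrix.cons_val]
    field_simp

/-- **`H = M²/Σ`** at the horizon points, i.e. `Σ · H = M²` (`H = Mr/Σ`, `r = M`).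
[cite: arXiv07060622, (33)] -/
theorem blSigma_mul_scalarH_horizonPoint {M : ℝ} (hM : 0 < M) (σ θ φ : ℝ) :
    Kerr.blSigma M (E4.spatial (horizonPoint M σ θ φ)) * Kerr.scalarH M M (horizonPoint M σ θ φ) =
      M ^ 2 := by
  have hr := radius_horizonPoint hM.le σ θ φ
  have hpos : 0 < Kerr.radius M (horizonPoint M σ θ φ) := by rw [hr]; exact hM
  have hS := Kerr.blSigma_spatial_pos hpos
  rw [Kerr.scalarH_eq_div_blSigma M M hpos, hr]
  field_simp

/-- The polar frame vector `Θ = ∂_θ` of the horizon spheres. [cite: Aretakis2015, §2.2] -/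
def thetaVec (M θ φ : ℝ) : E4 :=
  WithLp.toLp 2 ![0, M * Real.cos θ * (Real.cos φ - Real.sin φ),
    M * Real.cos θ * (Real.cos φ + Real.sin φ), -(M * Real.sin θ)]

/-- `∂_θ Θ` along the horizon spheres. [folklore] -/
def dThetaVec (M θ φ : ℝ) : E4 :=
  WithLp.toLp 2 ![0, -(M * Real.sin θ * (Real.cos φ - Real.sin φ)),
    -(M * Real.sin θ * (Real.cos φ + Real.sin φ)), -(M * Real.cos θ)]

/-- The normalised azimuthal frame vector `Φ̂ = ∂_φ* / sin θ` of the horizon spheres (smooth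
through the poles). [cite: Aretakis2015, §2.2] -/
def phiHatVec (M φ : ℝ) : E4 :=
  WithLp.toLp 2 ![0, -(M * (Real.sin φ + Real.cos φ)), M * (Real.cos φ - Real.sin φ), 0]

/-- `∂_φ Φ̂`. [folklore] -/
def dPhiHatVec (M φ : ℝ) : E4 :=
  WithLp.toLp 2 ![0, -(M * (Real.cos φ - Real.sin φ)), -(M * (Real.sin φ + Real.cos φ)), 0]

/-- `∂_φ ℓ♯` along the horizon spheres. [folklore] -/
def dPhiHorizonNull (θ φ : ℝ) : E4 :=
  WithLp.toLp 2 ![0, -(Real.sin θ * Real.sin φ), Real.sin θ * Real.cos φ, 0]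

/-- Two explicit vectors of `E4` agree iff their four components do. [folklore] -/
theorem toLp_four_eq {a₀ a₁ a₂ a₃ b₀ b₁ b₂ b₃ : ℝ} (h₀ : a₀ = b₀) (h₁ : a₁ = b₁) (h₂ : a₂ = b₂)
    (h₃ : a₃ = b₃) : (WithLp.toLp 2 ![a₀, a₁, a₂, a₃] : E4) = WithLp.toLp 2 ![b₀, b₁, b₂, b₃] := by
  rw [h₀, h₁, h₂, h₃]

/-- `∂_σ` of the horizon point is `∂_{t*}`. [folklore] -/
theorem hasDerivAt_horizonPoint_sigma (M σ θ φ : ℝ) :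
    HasDerivAt (fun σ ↦ horizonPoint M σ θ φ) (E4.basisVector 0) σ := by
  have h := ((hasDerivAt_id σ).smul_const (E4.basisVector 0)).const_add (extremalHorizonPoint M θ φ)
  simpa [horizonPoint] using h

/-- `∂_θ` of the horizon point is `Θ`. [folklore] -/
theorem hasDerivAt_horizonPoint_theta (M σ θ φ : ℝ) :
    HasDerivAt (fun θ ↦ horizonPoint M σ θ φ) (thetaVec M θ φ) θ := by
  have hfun : (fun θ ↦ horizonPoint M σ θ φ) = fun θ ↦ (WithLp.toLp 2 ![σ,
      M * Real.sin θ * (Real.cos φ - Real.sin φ), M * Real.sin θ * (Real.cos φ + Real.sin φ),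
      M * Real.cos θ] : E4) := funext fun θ ↦ horizonPoint_eq_toLp M σ θ φ
  rw [hfun]
  refine (hasDerivAt_toLp_four (hasDerivAt_const θ σ)
    (((Real.hasDerivAt_sin θ).const_mul M).mul_const _)
    (((Real.hasDerivAt_sin θ).const_mul M).mul_const _)
    ((Real.hasDerivAt_cos θ).const_mul M)).congr_deriv (toLp_four_eq rfl rfl rfl ?_)
  ring

/-- `∂_φ` of the horizon point is `sin θ · Φ̂`. [folklore] -/
theorem hasDerivAt_horizonPoint_phi (M σ θ φ : ℝ) :
    HasDerivAt (fun φ ↦ horizonPoint M σ θ φ) (Real.sin θ • phiHatVec M φ) φ := by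
  have hfun : (fun φ ↦ horizonPoint M σ θ φ) = fun φ ↦ (WithLp.toLp 2 ![σ,
      M * Real.sin θ * (Real.cos φ - Real.sin φ), M * Real.sin θ * (Real.cos φ + Real.sin φ),
      M * Real.cos θ] : E4) := funext fun φ ↦ horizonPoint_eq_toLp M σ θ φ
  have hvec : Real.sin θ • phiHatVec M φ = WithLp.toLp 2 ![0,
      M * Real.sin θ * (-Real.sin φ - Real.cos φ), M * Real.sin θ * (-Real.sin φ + Real.cos φ), 0] := by
    ext i
    fin_cases i <;> simp [phiHatVec] <;> ring
  rw [hfun, hvec]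
  refine (hasDerivAt_toLp_four (hasDerivAt_const φ σ)
    (((Real.hasDerivAt_cos φ).sub (Real.hasDerivAt_sin φ)).const_mul (M * Real.sin θ))
    (((Real.hasDerivAt_cos φ).add (Real.hasDerivAt_sin φ)).const_mul (M * Real.sin θ))
    (hasDerivAt_const φ (M * Real.cos θ))).congr_deriv (toLp_four_eq rfl ?_ ?_ rfl) <;> ring

/-- `∂_θ Θ = dThetaVec`. [folklore] -/
theorem hasDerivAt_thetaVec (M θ φ : ℝ) :
    HasDerivAt (fun θ ↦ thetaVec M θ φ) (dThetaVec M θ φ) θ := by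
  refine (hasDerivAt_toLp_four (hasDerivAt_const θ (0 : ℝ))
    (((Real.hasDerivAt_cos θ).const_mul M).mul_const _)
    (((Real.hasDerivAt_cos θ).const_mul M).mul_const _)
    ((Real.hasDerivAt_sin θ).const_mul M).neg).congr_deriv (toLp_four_eq rfl ?_ ?_ rfl) <;> ring

/-- `∂_φ Φ̂ = dPhiHatVec`. [folklore] -/
theorem hasDerivAt_phiHatVec (M φ : ℝ) :
    HasDerivAt (fun φ ↦ phiHatVec M φ) (dPhiHatVec M φ) φ := by
  refine (hasDerivAt_toLp_four (hasDerivAt_const φ (0 : ℝ))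
    (((Real.hasDerivAt_sin φ).add (Real.hasDerivAt_cos φ)).const_mul M).neg
    (((Real.hasDerivAt_cos φ).sub (Real.hasDerivAt_sin φ)).const_mul M)
    (hasDerivAt_const φ (0 : ℝ))).congr_deriv (toLp_four_eq rfl ?_ ?_ rfl) <;> ring

/-- `∂_φ ℓ♯ = dPhiHorizonNull` along the horizon spheres. [folklore] -/
theorem hasDerivAt_horizonNull_phi (θ φ : ℝ) :
    HasDerivAt (fun φ ↦ horizonNull θ φ) (dPhiHorizonNull θ φ) φ := by
  refine (hasDerivAt_toLp_four (hasDerivAt_const φ (-1 : ℝ))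
    ((Real.hasDerivAt_cos φ).const_mul (Real.sin θ))
    ((Real.hasDerivAt_sin φ).const_mul (Real.sin θ))
    (hasDerivAt_const φ (Real.cos θ))).congr_deriv (toLp_four_eq rfl ?_ rfl rfl)
  ring

/-! ### The inverse metric and the first-order coefficients on the horizon in the adapted frame -/

/-- Expansion of a bilinear form in the coordinate basis: `B(u, v) = ∑ u^μ v^ν B(∂_μ, ∂_ν)`.
[folklore] -/
theorem bilin_eq_sum_sum (B : E4 →L[ℝ] E4 →L[ℝ] ℝ) (u v : E4) :
    B u v = ∑ μ, ∑ ν, u μ * v ν * B (E4.basisVector μ) (E4.basisVector ν) := by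
  conv_lhs => rw [Kerr.eq_sum_basisVector u, map_sum]
  rw [FunLike.coe_sum, Finset.sum_apply]
  refine Finset.sum_congr rfl fun μ _ ↦ ?_
  rw [map_smul, FunLike.coe_smul, Pi.smul_apply, smul_eq_mul]
  conv_lhs => rw [Kerr.eq_sum_basisVector v, map_sum]
  rw [Finset.mul_sum]
  refine Finset.sum_congr rfl fun ν _ ↦ ?_
  rw [map_smul, smul_eq_mul]
  ring

/-- **The inverse extremal Kerr metric on the horizon in the adapted frame** `(T, Y, Θ, Φ̂)`,
`T = ∂_{t*} = ∂_v`, `Y = ℓ♯ = ∂_r`, `Θ = ∂_θ`, `Φ̂ = ∂_φ*/sin θ`: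
`Σ · g⁻¹ = M² sin² θ T⊗T + 2M² (T⊗Y + Y⊗T) + M sin θ (T⊗Φ̂ + Φ̂⊗T) + M sin θ (Y⊗Φ̂ + Φ̂⊗Y) + Θ⊗Θ + Φ̂⊗Φ̂`
with `Σ = ρ² = M²(1 + cos² θ)`, contracted against an arbitrary bilinear form `B`. These are the printed
components `g^{vv} = M² sin² θ/ρ²`, `g^{vr} = (r² + M²)/ρ² = 2M²/ρ²`, `g^{vφ*} = g^{rφ*} = M/ρ²`,
`g^{θθ} = 1/ρ²`, `g^{φ*φ*} = 1/(ρ² sin² θ)` and `g^{rr} = Δ/ρ² = 0` at `r = M` (no `YY` term on the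
horizon: the extremal degeneration used in Prop. 3.1). Aretakis, ATMP 19 (2015), §5.2 (inverse metric
display). [cite: Aretakis2015, §5.2] -/
theorem blSigma_mul_sum_inverseMetric_horizon {M : ℝ} (hM : 0 < M) (σ θ φ : ℝ)
    (B : E4 →L[ℝ] E4 →L[ℝ] ℝ) :
    Kerr.blSigma M (E4.spatial (horizonPoint M σ θ φ)) *
        ∑ μ, ∑ ν, Kerr.inverseMetric M M (horizonPoint M σ θ φ) μ ν *
          B (E4.basisVector μ) (E4.basisVector ν) =
      M ^ 2 * Real.sin θ ^ 2 * B (E4.basisVector 0) (E4.basisVector 0) +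
      2 * M ^ 2 * (B (E4.basisVector 0) (horizonNull θ φ) + B (horizonNull θ φ) (E4.basisVector 0)) +
      M * Real.sin θ *
        (B (E4.basisVector 0) (phiHatVec M φ) + B (phiHatVec M φ) (E4.basisVector 0)) +
      M * Real.sin θ *
        (B (horizonNull θ φ) (phiHatVec M φ) + B (phiHatVec M φ) (horizonNull θ φ)) +
      B (thetaVec M θ φ) (thetaVec M θ φ) + B (phiHatVec M φ) (phiHatVec M φ) := by
  set p := horizonPoint M σ θ φ with hp
  have hSH := blSigma_mul_scalarH_horizonPoint hM σ θ φ
  have hS := blSigma_horizonPoint hM.le σ θ φ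
  rw [← hp] at hSH hS
  set S := Kerr.blSigma M (E4.spatial p) with hSdef
  set Hh := Kerr.scalarH M M p with hHdef
  have hV : Kerr.nullVector M p = horizonNull θ φ := nullVector_horizonPoint hM σ θ φ
  -- expand the inverse metric and use `S · H = M²`
  have hexp : S * ∑ μ, ∑ ν, Kerr.inverseMetric M M p μ ν * B (E4.basisVector μ) (E4.basisVector ν) =
      S * ∑ μ, ∑ ν, Kerr.etaComp μ ν * B (E4.basisVector μ) (E4.basisVector ν) -
        2 * M ^ 2 * ∑ μ, ∑ ν, horizonNull θ φ ν * horizonNull θ φ μ *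
          B (E4.basisVector μ) (E4.basisVector ν) := by
    have h1 : ∀ μ ν, Kerr.inverseMetric M M p μ ν * B (E4.basisVector μ) (E4.basisVector ν) =
        Kerr.etaComp μ ν * B (E4.basisVector μ) (E4.basisVector ν) -
          2 * Hh * (horizonNull θ φ ν * horizonNull θ φ μ *
            B (E4.basisVector μ) (E4.basisVector ν)) := by
      intro μ ν
      rw [Kerr.inverseMetric_apply, hV]
      simp only [Kerr.etaComp]
      ring
    simp only [h1, Finset.sum_sub_distrib, ← Finset.mul_sum, mul_sub]
    congr 1
    rw [← mul_assoc, ← mul_assoc, show S * 2 * Hh = 2 * (S * Hh) by ring, hSH]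
  rw [hexp, hS, bilin_eq_sum_sum B (E4.basisVector 0) (horizonNull θ φ),
    bilin_eq_sum_sum B (horizonNull θ φ) (E4.basisVector 0),
    bilin_eq_sum_sum B (E4.basisVector 0) (phiHatVec M φ),
    bilin_eq_sum_sum B (phiHatVec M φ) (E4.basisVector 0),
    bilin_eq_sum_sum B (horizonNull θ φ) (phiHatVec M φ),
    bilin_eq_sum_sum B (phiHatVec M φ) (horizonNull θ φ),
    bilin_eq_sum_sum B (thetaVec M θ φ) (thetaVec M θ φ),
    bilin_eq_sum_sum B (phiHatVec M φ) (phiHatVec M φ)]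
  simp only [Fin.sum_univ_four, Kerr.etaComp, horizonNull, thetaVec, phiHatVec, basisVector_apply,
    PiLp.toLp_apply, Matrix.cons_val_zero, Matrix.cons_val_one, Matrix.cons_val, Fin.isValue,
    Fin.reduceEq, ↓reduceIte]
  ring_nf
  simp only [Real.cos_sq']
  ring_nf

/-- **The first-order coefficients on the horizon in the adapted frame.** With `Σ ∑_μ ∂_μ g^{μν} =
−2M ℓ^ν` (`Kerr.divInverseMetric_eq`) and the frame derivatives one has the vector identity
`−2M sin θ (ℓ♯ + ∂_{t*}) = 2M sin θ ∂_φ ℓ♯ + ∂_φ Φ̂ + cos θ Θ + sin θ ∂_θ Θ`; it says that the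
first-order terms of `sin θ · Σ □_g` on the horizon are exactly `2M sin θ · Tψ` (Aretakis's
`(2r/ρ²) Tψ` at `r = M`; the `Yψ` coefficient `Δ'/ρ²` vanishes) plus the first-order parts of the
tangential total derivatives `∂_φ[2M sin θ (Tψ + Yψ) + Φ̂ψ] + ∂_θ[sin θ Θψ]`.
[cite: Aretakis2015, §5.2] -/
theorem horizon_firstOrder_identity (M θ φ : ℝ) :
    -(2 * M * Real.sin θ) • (horizonNull θ φ + E4.basisVector 0) =
      (2 * M * Real.sin θ) • dPhiHorizonNull θ φ + dPhiHatVec M φ + Real.cos θ • thetaVec M θ φ +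
        Real.sin θ • dThetaVec M θ φ := by
  ext i
  fin_cases i <;>
    simp only [horizonNull, dPhiHorizonNull, dPhiHatVec, thetaVec, dThetaVec, basisVector_apply,
      PiLp.add_apply, PiLp.smul_apply, smul_eq_mul,
      Matrix.cons_val_zero, Matrix.cons_val_one, Matrix.cons_val, Fin.isValue,
      Fin.reduceEq, ↓reduceIte, Fin.zero_eta, Fin.mk_one, Fin.reduceFinMk] <;>
    ring_nf <;> simp only [Real.cos_sq'] <;> ring_nf

/-! ### The wave operator in Kerr–Schild coordinates: Hessian part plus first-order part -/

/-- **`□_g ψ = ∑ g^{μν} ∂_μ∂_ν Φ + ∑ c^ν ∂_ν Φ`** with `c^ν = ∑_μ ∂_μ g^{μν}` (`Kerr.divInverseMetric`):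
the divergence form `Kerr.dalembertian_eq_divergence` expanded by the product rule, for a
representative `Φ` of class `C²` at `x`. Kerr–Schild 1965, §2. [cite: KerrSchild1965, §2] -/
theorem dalembertian_eq_hessian_add_firstOrder [Kerr.Facts] [Kerr.SliceFacts] (M a r₀ : ℝ)
    {ψ : Kerr.region a r₀ → ℝ} {Φ : E4 → ℝ} (hψ : ∀ y, ψ y = Φ y) (x : Kerr.region a r₀)
    (hΦ : ContDiffAt ℝ 2 Φ x) :
    (Kerr.smoothMetric M a r₀).toPseudoRiemannianMetric.dalembertian ψ x =
      ∑ μ, ∑ ν, Kerr.inverseMetric M a x μ ν *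
          fderiv ℝ (fderiv ℝ Φ) x (E4.basisVector μ) (E4.basisVector ν) +
        ∑ ν, Kerr.divInverseMetric M a x ν * fderiv ℝ Φ x (E4.basisVector ν) := by
  have hx := Kerr.radius_pos_of_mem_region x.2
  rw [Kerr.dalembertian_eq_divergence M a r₀ hψ x hΦ]
  have hΦ2 : DifferentiableAt ℝ (fderiv ℝ Φ) x :=
    (hΦ.fderiv_right (m := 1) le_rfl).differentiableAt one_ne_zero
  have hdiv : ∀ μ, fderiv ℝ (fun y ↦ ∑ ν, Kerr.inverseMetric M a y μ ν *
      fderiv ℝ Φ y (E4.basisVector ν)) x (E4.basisVector μ) =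
      ∑ ν, (fderiv ℝ (fun y ↦ Kerr.inverseMetric M a y μ ν) x (E4.basisVector μ) *
        fderiv ℝ Φ x (E4.basisVector ν) +
        Kerr.inverseMetric M a x μ ν * fderiv ℝ (fderiv ℝ Φ) x (E4.basisVector μ)
          (E4.basisVector ν)) := by
    intro μ
    have hdf : ∀ ν, HasFDerivAt (fun y ↦ Kerr.inverseMetric M a y μ ν)
        (fderiv ℝ (fun y ↦ Kerr.inverseMetric M a y μ ν) x) x := fun ν ↦
      ((Kerr.contDiffAt_inverseMetric M a hx μ ν (n := 1)).differentiableAt one_ne_zero).hasFDerivAt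
    have hdΦ : ∀ ν, HasFDerivAt (fun y ↦ fderiv ℝ Φ y (E4.basisVector ν))
        ((fderiv ℝ (fderiv ℝ Φ) x).flip (E4.basisVector ν)) x := by
      intro ν
      have := hΦ2.hasFDerivAt.clm_apply (hasFDerivAt_const (E4.basisVector ν) (x : E4))
      simpa using this
    have hsum := HasFDerivAt.fun_sum fun ν (_ : ν ∈ Finset.univ) ↦ (hdf ν).mul (hdΦ ν)
    rw [show (fun y ↦ ∑ ν, Kerr.inverseMetric M a y μ ν * fderiv ℝ Φ y (E4.basisVector ν)) =
      fun y ↦ ∑ ν, ((fun y ↦ Kerr.inverseMetric M a y μ ν) * fun y ↦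
        fderiv ℝ Φ y (E4.basisVector ν)) y from rfl, hsum.fderiv]
    simp only [FunLike.coe_sum, Finset.sum_apply, FunLike.coe_add, Pi.add_apply,
      FunLike.coe_smul, Pi.smul_apply, smul_eq_mul, ContinuousLinearMap.flip_apply]
    exact Finset.sum_congr rfl fun ν _ ↦ by ring
  simp only [hdiv, Finset.sum_add_distrib]
  rw [add_comm]
  congr 1
  simp only [Kerr.divInverseMetric, Finset.sum_mul]
  rw [Finset.sum_comm]

/-! ### The charge density and the tangential fluxes as functions of `(σ, θ, φ)` -/

/-- The charge density `(M sin² θ · TΨ + 4M · YΨ + 2Ψ)(p_σ(θ, φ)) · 2M² sin θ` of a function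
`Ψ : E4 → ℝ` (a representative of `ψ`); for `Ψ = extend ψ 0` this is `aretakisChargeDensityAt`
(`aretakisChargeDensityAt_eq_densityFun`). [cite: Aretakis2015, §5.2] -/
def densityFun (M : ℝ) (Ψ : E4 → ℝ) (σ θ φ : ℝ) : ℝ :=
  (M * Real.sin θ ^ 2 * fderiv ℝ Ψ (horizonPoint M σ θ φ) (E4.basisVector 0) +
    4 * M * fderiv ℝ Ψ (horizonPoint M σ θ φ) (Kerr.nullVector M (horizonPoint M σ θ φ)) +
    2 * Ψ (horizonPoint M σ θ φ)) * (2 * M ^ 2 * Real.sin θ)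

/-- The azimuthal flux `E = 2M sin θ (TΨ + YΨ) + Φ̂Ψ` whose `φ`-derivative appears in the horizon
identity. [cite: Aretakis2015, Prop. 3.1] -/
def phiFlux (M : ℝ) (Ψ : E4 → ℝ) (σ θ φ : ℝ) : ℝ :=
  2 * M * Real.sin θ * (fderiv ℝ Ψ (horizonPoint M σ θ φ) (E4.basisVector 0) +
      fderiv ℝ Ψ (horizonPoint M σ θ φ) (horizonNull θ φ)) +
    fderiv ℝ Ψ (horizonPoint M σ θ φ) (phiHatVec M φ)

/-- The polar flux `sin θ · ΘΨ` whose `θ`-derivative appears in the horizon identity (it vanishes at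
the poles `θ = 0, π`). [cite: Aretakis2015, Prop. 3.1] -/
def thetaFlux (M : ℝ) (Ψ : E4 → ℝ) (σ θ φ : ℝ) : ℝ :=
  Real.sin θ * fderiv ℝ Ψ (horizonPoint M σ θ φ) (thetaVec M θ φ)

/-- The vendored density is the density function of the representative `extend ψ 0`.
[cite: Aretakis2015, §5.2] -/
theorem aretakisChargeDensityAt_eq_densityFun (M r₀ : ℝ) (ψ : Kerr.region M r₀ → ℝ) (σ θ φ : ℝ) :
    aretakisChargeDensityAt M r₀ ψ σ θ φ = densityFun M (Function.extend Subtype.val ψ 0) σ θ φ :=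
  rfl

/-- The polar flux vanishes at the poles. [folklore] -/
theorem thetaFlux_zero (M : ℝ) (Ψ : E4 → ℝ) (σ φ : ℝ) : thetaFlux M Ψ σ 0 φ = 0 := by
  simp [thetaFlux]

/-- The polar flux vanishes at the poles. [folklore] -/
theorem thetaFlux_pi (M : ℝ) (Ψ : E4 → ℝ) (σ φ : ℝ) : thetaFlux M Ψ σ Real.pi φ = 0 := by
  simp [thetaFlux]

/-- The horizon point is `2π`-periodic in `φ`. [folklore] -/
theorem horizonPoint_add_two_pi (M σ θ φ : ℝ) :
    horizonPoint M σ θ (φ + 2 * Real.pi) = horizonPoint M σ θ φ := by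
  rw [horizonPoint_eq_toLp, horizonPoint_eq_toLp, Real.cos_add_two_pi, Real.sin_add_two_pi]

/-- The azimuthal flux is `2π`-periodic in `φ`. [folklore] -/
theorem phiFlux_add_two_pi (M : ℝ) (Ψ : E4 → ℝ) (σ θ φ : ℝ) :
    phiFlux M Ψ σ θ (φ + 2 * Real.pi) = phiFlux M Ψ σ θ φ := by
  simp only [phiFlux, horizonPoint_add_two_pi, horizonNull, phiHatVec, Real.cos_add_two_pi,
    Real.sin_add_two_pi]

section Derivatives

variable {M : ℝ} {Ψ : E4 → ℝ}

/-- **`∂_σ` of the density**: `2M² sin θ (M sin² θ · TTΨ + 4M · TYΨ + 2 TΨ)` (`ℓ♯` does not depend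
on `t*`). [cite: Aretakis2015, Prop. 3.1] -/
theorem hasDerivAt_densityFun_sigma (hM : 0 < M) {σ θ φ : ℝ}
    (hΨ : ContDiffAt ℝ 2 Ψ (horizonPoint M σ θ φ)) :
    HasDerivAt (fun σ' ↦ densityFun M Ψ σ' θ φ)
      (2 * M ^ 2 * Real.sin θ *
        (M * Real.sin θ ^ 2 * fderiv ℝ (fderiv ℝ Ψ) (horizonPoint M σ θ φ) (E4.basisVector 0)
            (E4.basisVector 0) +
          4 * M * fderiv ℝ (fderiv ℝ Ψ) (horizonPoint M σ θ φ) (E4.basisVector 0) (horizonNull θ φ) +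
          2 * fderiv ℝ Ψ (horizonPoint M σ θ φ) (E4.basisVector 0))) σ := by
  set p := horizonPoint M σ θ φ with hp
  have hcurve : HasDerivAt (fun σ' ↦ horizonPoint M σ' θ φ) (E4.basisVector 0) σ :=
    hasDerivAt_horizonPoint_sigma M σ θ φ
  have hL : HasFDerivAt Ψ (fderiv ℝ Ψ p) p := (hΨ.differentiableAt two_ne_zero).hasFDerivAt
  have hB : HasFDerivAt (fderiv ℝ Ψ) (fderiv ℝ (fderiv ℝ Ψ) p) p :=
    ((hΨ.fderiv_right (m := 1) le_rfl).differentiableAt one_ne_zero).hasFDerivAt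
  have h0 : HasDerivAt (fun σ' ↦ Ψ (horizonPoint M σ' θ φ)) (fderiv ℝ Ψ p (E4.basisVector 0)) σ :=
    hL.comp_hasDerivAt σ hcurve
  have hc : HasDerivAt (fun σ' ↦ fderiv ℝ Ψ (horizonPoint M σ' θ φ))
      (fderiv ℝ (fderiv ℝ Ψ) p (E4.basisVector 0)) σ := hB.comp_hasDerivAt σ hcurve
  have h1 : HasDerivAt (fun σ' ↦ fderiv ℝ Ψ (horizonPoint M σ' θ φ) (E4.basisVector 0))
      (fderiv ℝ (fderiv ℝ Ψ) p (E4.basisVector 0) (E4.basisVector 0)) σ := by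
    simpa using hc.clm_apply (hasDerivAt_const σ (E4.basisVector 0))
  have h2 : HasDerivAt (fun σ' ↦ fderiv ℝ Ψ (horizonPoint M σ' θ φ)
      (Kerr.nullVector M (horizonPoint M σ' θ φ)))
      (fderiv ℝ (fderiv ℝ Ψ) p (E4.basisVector 0) (horizonNull θ φ)) σ := by
    have hfun : (fun σ' ↦ fderiv ℝ Ψ (horizonPoint M σ' θ φ)
        (Kerr.nullVector M (horizonPoint M σ' θ φ))) =
        fun σ' ↦ fderiv ℝ Ψ (horizonPoint M σ' θ φ) (horizonNull θ φ) := by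
      funext σ'; rw [nullVector_horizonPoint hM]
    rw [hfun]
    simpa using hc.clm_apply (hasDerivAt_const σ (horizonNull θ φ))
  have h := (((h1.const_mul (M * Real.sin θ ^ 2)).add (h2.const_mul (4 * M))).add
    (h0.const_mul 2)).mul_const (2 * M ^ 2 * Real.sin θ)
  refine (h.congr_of_eventuallyEq (Eventually.of_forall fun σ' ↦ rfl)).congr_deriv ?_
  rw [hp]
  ring

/-- **`∂_θ` of the polar flux**: `cos θ · ΘΨ + sin θ (ΘΘΨ + (∂_θΘ)Ψ)`. [folklore] -/
theorem hasDerivAt_thetaFlux_theta {σ θ φ : ℝ} (hΨ : ContDiffAt ℝ 2 Ψ (horizonPoint M σ θ φ)) :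
    HasDerivAt (fun θ' ↦ thetaFlux M Ψ σ θ' φ)
      (Real.cos θ * fderiv ℝ Ψ (horizonPoint M σ θ φ) (thetaVec M θ φ) +
        Real.sin θ * (fderiv ℝ (fderiv ℝ Ψ) (horizonPoint M σ θ φ) (thetaVec M θ φ) (thetaVec M θ φ) +
          fderiv ℝ Ψ (horizonPoint M σ θ φ) (dThetaVec M θ φ))) θ := by
  set p := horizonPoint M σ θ φ with hp
  have hcurve := hasDerivAt_horizonPoint_theta M σ θ φ
  have hB : HasFDerivAt (fderiv ℝ Ψ) (fderiv ℝ (fderiv ℝ Ψ) p) p :=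
    ((hΨ.fderiv_right (m := 1) le_rfl).differentiableAt one_ne_zero).hasFDerivAt
  have hc : HasDerivAt (fun θ' ↦ fderiv ℝ Ψ (horizonPoint M σ θ' φ))
      (fderiv ℝ (fderiv ℝ Ψ) p (thetaVec M θ φ)) θ := hB.comp_hasDerivAt θ hcurve
  have h1 := hc.clm_apply (hasDerivAt_thetaVec M θ φ)
  have h := (Real.hasDerivAt_sin θ).mul h1
  refine (h.congr_of_eventuallyEq (Eventually.of_forall fun θ' ↦ rfl)).congr_deriv ?_
  rw [hp]

/-- **`∂_φ` of the azimuthal flux**: `2M sin θ (ΦTΨ + ΦYΨ + (∂_φℓ♯)Ψ) + ΦΦ̂Ψ + (∂_φΦ̂)Ψ` with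
`Φ = ∂_φ = sin θ Φ̂`. [folklore] -/
theorem hasDerivAt_phiFlux_phi {σ θ φ : ℝ} (hΨ : ContDiffAt ℝ 2 Ψ (horizonPoint M σ θ φ)) :
    HasDerivAt (fun φ' ↦ phiFlux M Ψ σ θ φ')
      (2 * M * Real.sin θ *
          (fderiv ℝ (fderiv ℝ Ψ) (horizonPoint M σ θ φ) (Real.sin θ • phiHatVec M φ) (E4.basisVector 0) +
            (fderiv ℝ (fderiv ℝ Ψ) (horizonPoint M σ θ φ) (Real.sin θ • phiHatVec M φ) (horizonNull θ φ) +
              fderiv ℝ Ψ (horizonPoint M σ θ φ) (dPhiHorizonNull θ φ))) +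
        (fderiv ℝ (fderiv ℝ Ψ) (horizonPoint M σ θ φ) (Real.sin θ • phiHatVec M φ) (phiHatVec M φ) +
          fderiv ℝ Ψ (horizonPoint M σ θ φ) (dPhiHatVec M φ))) φ := by
  set p := horizonPoint M σ θ φ with hp
  have hcurve := hasDerivAt_horizonPoint_phi M σ θ φ
  have hB : HasFDerivAt (fderiv ℝ Ψ) (fderiv ℝ (fderiv ℝ Ψ) p) p :=
    ((hΨ.fderiv_right (m := 1) le_rfl).differentiableAt one_ne_zero).hasFDerivAt
  have hc : HasDerivAt (fun φ' ↦ fderiv ℝ Ψ (horizonPoint M σ θ φ'))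
      (fderiv ℝ (fderiv ℝ Ψ) p (Real.sin θ • phiHatVec M φ)) φ := hB.comp_hasDerivAt φ hcurve
  have h1 : HasDerivAt (fun φ' ↦ fderiv ℝ Ψ (horizonPoint M σ θ φ') (E4.basisVector 0))
      (fderiv ℝ (fderiv ℝ Ψ) p (Real.sin θ • phiHatVec M φ) (E4.basisVector 0)) φ := by
    simpa using hc.clm_apply (hasDerivAt_const φ (E4.basisVector 0))
  have h2 := hc.clm_apply (hasDerivAt_horizonNull_phi θ φ)
  have h3 := hc.clm_apply (hasDerivAt_phiHatVec M φ)
  have h := (((h1.add h2).const_mul (2 * M * Real.sin θ))).add h3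
  refine (h.congr_of_eventuallyEq (Eventually.of_forall fun φ' ↦ rfl)).congr_deriv ?_
  rw [hp]

end Derivatives

/-! ### The horizon identity: `∂_σ` of the density is a sum of tangential total derivatives -/

/-- **The pointwise horizon identity.** At a horizon point `p = p_σ(θ, φ)`, for any symmetric
bilinear form `B` (the Hessian of `Ψ`) and any linear form `L` (its differential):
`M sin θ (M sin² θ B(T,T) + 4M B(T,Y) + 2L(T)) + [∂_φ E] + [∂_θ(sin θ ΘΨ)]
 = sin θ · Σ · (∑ g^{μν} B(∂_μ,∂_ν) + ∑ c^ν L(∂_ν))`,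
where the brackets are the expressions of `hasDerivAt_phiFlux_phi` and `hasDerivAt_thetaFlux_theta`.
This is `sin θ · ρ² □_g` on `𝓗⁺` from Aretakis's formula (§5.2) with `Δ = Δ' = 0` at `r = M`:
`ρ² □_g ψ = M² sin² θ TTψ + 4M² TYψ + 2M TΦψ + 2M YΦψ + 2M Tψ + ∆_{S²} ψ`.
[cite: Aretakis2015, §5.2 and Prop. 3.1] -/
theorem horizon_density_deriv_identity {M : ℝ} (hM : 0 < M) (σ θ φ : ℝ)
    (B : E4 →L[ℝ] E4 →L[ℝ] ℝ) (hB : ∀ v w, B v w = B w v) (L : E4 →L[ℝ] ℝ) :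
    M * Real.sin θ * (M * Real.sin θ ^ 2 * B (E4.basisVector 0) (E4.basisVector 0) +
        4 * M * B (E4.basisVector 0) (horizonNull θ φ) + 2 * L (E4.basisVector 0)) +
      (2 * M * Real.sin θ * (B (Real.sin θ • phiHatVec M φ) (E4.basisVector 0) +
          (B (Real.sin θ • phiHatVec M φ) (horizonNull θ φ) + L (dPhiHorizonNull θ φ))) +
        (B (Real.sin θ • phiHatVec M φ) (phiHatVec M φ) + L (dPhiHatVec M φ))) +
      (Real.cos θ * L (thetaVec M θ φ) +
        Real.sin θ * (B (thetaVec M θ φ) (thetaVec M θ φ) + L (dThetaVec M θ φ))) =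
    Real.sin θ * (Kerr.blSigma M (E4.spatial (horizonPoint M σ θ φ)) *
      (∑ μ, ∑ ν, Kerr.inverseMetric M M (horizonPoint M σ θ φ) μ ν *
          B (E4.basisVector μ) (E4.basisVector ν) +
        ∑ ν, Kerr.divInverseMetric M M (horizonPoint M σ θ φ) ν * L (E4.basisVector ν))) := by
  set p := horizonPoint M σ θ φ with hp
  have hpos : 0 < Kerr.radius M p := by rw [hp, radius_horizonPoint hM.le]; exact hM
  have hS := Kerr.blSigma_spatial_pos hpos
  -- second-order part
  have h2 := blSigma_mul_sum_inverseMetric_horizon hM σ θ φ B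
  rw [← hp] at h2
  -- first-order part: `Σ ∑ c^ν L(∂_ν) = −2M L(ℓ♯)`
  have h1 : Kerr.blSigma M (E4.spatial p) *
      ∑ ν, Kerr.divInverseMetric M M p ν * L (E4.basisVector ν) = -(2 * M) * L (horizonNull θ φ) := by
    have hc : ∀ ν, Kerr.divInverseMetric M M p ν * L (E4.basisVector ν) =
        -(2 * M / Kerr.blSigma M (E4.spatial p)) * (L (E4.basisVector ν) * Kerr.nullVector M p ν) := by
      intro ν; rw [Kerr.divInverseMetric_eq M M hpos ν]; ring
    simp only [hc, ← Finset.mul_sum, Kerr.sum_apply_basisVector_mul_nullVector L M p]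
    rw [hp, nullVector_horizonPoint hM, ← hp]
    field_simp
  -- the vector identity applied to `L`
  have h3 := congrArg L (horizon_firstOrder_identity M θ φ)
  simp only [map_add, map_smul, smul_eq_mul, neg_mul] at h3
  -- symmetry and bilinearity
  have hs1 : B (horizonNull θ φ) (E4.basisVector 0) = B (E4.basisVector 0) (horizonNull θ φ) := hB _ _
  have hs2 : B (phiHatVec M φ) (E4.basisVector 0) = B (E4.basisVector 0) (phiHatVec M φ) := hB _ _
  have hs3 : B (phiHatVec M φ) (horizonNull θ φ) = B (horizonNull θ φ) (phiHatVec M φ) := hB _ _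
  have hR : Real.sin θ * (Kerr.blSigma M (E4.spatial p) *
      (∑ μ, ∑ ν, Kerr.inverseMetric M M p μ ν * B (E4.basisVector μ) (E4.basisVector ν) +
        ∑ ν, Kerr.divInverseMetric M M p ν * L (E4.basisVector ν))) =
      Real.sin θ * (Kerr.blSigma M (E4.spatial p) *
        ∑ μ, ∑ ν, Kerr.inverseMetric M M p μ ν * B (E4.basisVector μ) (E4.basisVector ν)) +
      Real.sin θ * (Kerr.blSigma M (E4.spatial p) *
        ∑ ν, Kerr.divInverseMetric M M p ν * L (E4.basisVector ν)) := by ring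
  rw [hR, h2, h1]
  simp only [map_smul, FunLike.coe_smul, Pi.smul_apply, smul_eq_mul, hs1, hs2, hs3]
  linear_combination -h3

/-! ### Analysis on the sphere: Fubini for continuous integrands and the abstract conservation lemma -/

/-- Fubini for a continuous integrand on a rectangle, in interval-integral form. [folklore] -/
theorem intervalIntegral_swap_of_continuous {f : ℝ → ℝ → ℝ} (hf : Continuous (Function.uncurry f))
    {a b c d : ℝ} (hab : a ≤ b) (hcd : c ≤ d) :
    ∫ x in a..b, ∫ y in c..d, f x y = ∫ y in c..d, ∫ x in a..b, f x y := by
  simp only [intervalIntegral.integral_of_le hab, intervalIntegral.integral_of_le hcd]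
  have hint : Integrable (Function.uncurry f)
      (((volume : Measure ℝ).restrict (Ioc a b)).prod ((volume : Measure ℝ).restrict (Ioc c d))) := by
    rw [Measure.prod_restrict, ← Measure.volume_eq_prod]
    exact (hf.continuousOn.integrableOn_compact (isCompact_Icc.prod isCompact_Icc)).mono_set
      (Set.prod_mono Ioc_subset_Icc_self Ioc_subset_Icc_self)
  exact MeasureTheory.integral_integral_swap hint

/-- An explicit map into `E4` with continuous components is continuous. [folklore] -/
theorem continuous_toLp_four {X : Type*} [TopologicalSpace X] {f₀ f₁ f₂ f₃ : X → ℝ}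
    (h₀ : Continuous f₀) (h₁ : Continuous f₁) (h₂ : Continuous f₂) (h₃ : Continuous f₃) :
    Continuous fun x ↦ (WithLp.toLp 2 ![f₀ x, f₁ x, f₂ x, f₃ x] : E4) := by
  refine (PiLp.continuous_toLp 2 _).comp ?_
  refine continuous_pi fun i ↦ ?_
  fin_cases i
  · simpa using h₀
  · simpa using h₁
  · simpa using h₂
  · simpa using h₃

/-- **The abstract conservation lemma on the sphere.** If the `σ`-derivative of a density
`D(σ, θ, φ)` is `c · (∂_φ E + ∂_θ T)` with `E` `2π`-periodic in `φ` and `T` vanishing at the poles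
`θ = 0, π` — everything for `σ ≥ 0`, with the derivatives jointly continuous — then the sphere
integral `∫₀^{2π} ∫₀^π D(σ, θ, φ) dθ dφ` is the same at `σ = τ ≥ 0` and `σ = 0` (fundamental
theorem of calculus in `σ`, Fubini, and the vanishing of the tangential total derivatives after
integration over the sphere; the mechanism of Aretakis's Prop. 3.1). [cite: Aretakis2015, Prop. 3.1] -/
theorem sphereIntegral_eq_of_hasDerivAt {D E T dE dT : ℝ → ℝ → ℝ → ℝ} {c τ : ℝ} (hτ : 0 ≤ τ)
    (hD : ∀ σ θ φ, 0 ≤ σ → HasDerivAt (fun σ' ↦ D σ' θ φ) (c * (dE σ θ φ + dT σ θ φ)) σ)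
    (hE : ∀ σ θ φ, 0 ≤ σ → HasDerivAt (fun φ' ↦ E σ θ φ') (dE σ θ φ) φ)
    (hEper : ∀ σ θ, 0 ≤ σ → E σ θ (2 * Real.pi) = E σ θ 0)
    (hT : ∀ σ θ φ, 0 ≤ σ → HasDerivAt (fun θ' ↦ T σ θ' φ) (dT σ θ φ) θ)
    (hT0 : ∀ σ φ, T σ 0 φ = 0) (hTπ : ∀ σ φ, T σ Real.pi φ = 0)
    (hdE : Continuous fun q : ℝ × ℝ × ℝ ↦ dE (max q.1 0) q.2.1 q.2.2)
    (hdT : Continuous fun q : ℝ × ℝ × ℝ ↦ dT (max q.1 0) q.2.1 q.2.2)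
    (hDc : ∀ σ, 0 ≤ σ → Continuous fun q : ℝ × ℝ ↦ D σ q.1 q.2) :
    ∫ φ in (0 : ℝ)..2 * Real.pi, ∫ θ in (0 : ℝ)..Real.pi, D τ θ φ =
      ∫ φ in (0 : ℝ)..2 * Real.pi, ∫ θ in (0 : ℝ)..Real.pi, D 0 θ φ := by
  have hπ : (0 : ℝ) ≤ Real.pi := Real.pi_pos.le
  have h2π : (0 : ℝ) ≤ 2 * Real.pi := by positivity
  -- clamped, globally continuous integrands
  set F : ℝ → ℝ → ℝ → ℝ := fun σ θ φ ↦ dE (max σ 0) θ φ with hF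
  set G : ℝ → ℝ → ℝ → ℝ := fun σ θ φ ↦ dT (max σ 0) θ φ with hG
  have hFc : Continuous fun q : ℝ × ℝ × ℝ ↦ F q.1 q.2.1 q.2.2 := hdE
  have hGc : Continuous fun q : ℝ × ℝ × ℝ ↦ G q.1 q.2.1 q.2.2 := hdT
  -- continuity in various groupings
  have hF_σθ : ∀ φ, Continuous (Function.uncurry fun σ θ ↦ F σ θ φ) := fun φ ↦
    hFc.comp (Continuous.prodMk continuous_fst (Continuous.prodMk continuous_snd continuous_const))
  have hG_σθ : ∀ φ, Continuous (Function.uncurry fun σ θ ↦ G σ θ φ) := fun φ ↦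
    hGc.comp (Continuous.prodMk continuous_fst (Continuous.prodMk continuous_snd continuous_const))
  have hG_θσ : ∀ φ, Continuous (Function.uncurry fun θ σ ↦ G σ θ φ) := fun φ ↦
    hGc.comp (Continuous.prodMk continuous_snd (Continuous.prodMk continuous_fst continuous_const))
  have hF_φσ : ∀ θ, Continuous (Function.uncurry fun φ σ ↦ F σ θ φ) := fun θ ↦
    hFc.comp (Continuous.prodMk continuous_snd (Continuous.prodMk continuous_const continuous_fst))
  have hF_σ : ∀ θ φ, Continuous fun σ ↦ F σ θ φ := fun θ φ ↦
    hFc.comp (Continuous.prodMk continuous_id (Continuous.prodMk continuous_const continuous_const))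
  have hG_σ : ∀ θ φ, Continuous fun σ ↦ G σ θ φ := fun θ φ ↦
    hGc.comp (Continuous.prodMk continuous_id (Continuous.prodMk continuous_const continuous_const))
  have hG_θ : ∀ σ φ, Continuous fun θ ↦ G σ θ φ := fun σ φ ↦
    hGc.comp (Continuous.prodMk continuous_const (Continuous.prodMk continuous_id continuous_const))
  have hF_φ : ∀ σ θ, Continuous fun φ ↦ F σ θ φ := fun σ θ ↦
    hFc.comp (Continuous.prodMk continuous_const (Continuous.prodMk continuous_const continuous_id))
  -- parametric integrals in `σ` are continuous in the remaining variables
  have hIF : Continuous (Function.uncurry fun φ θ ↦ ∫ σ in (0 : ℝ)..τ, F σ θ φ) := by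
    have h : Continuous (Function.uncurry fun (q : ℝ × ℝ) σ ↦ F σ q.2 q.1) :=
      hFc.comp (Continuous.prodMk continuous_snd (Continuous.prodMk (continuous_snd.comp continuous_fst)
        (continuous_fst.comp continuous_fst)))
    exact intervalIntegral.continuous_parametric_intervalIntegral_of_continuous' h 0 τ
  have hIG : Continuous (Function.uncurry fun φ θ ↦ ∫ σ in (0 : ℝ)..τ, G σ θ φ) := by
    have h : Continuous (Function.uncurry fun (q : ℝ × ℝ) σ ↦ G σ q.2 q.1) :=
      hGc.comp (Continuous.prodMk continuous_snd (Continuous.prodMk (continuous_snd.comp continuous_fst)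
        (continuous_fst.comp continuous_fst)))
    exact intervalIntegral.continuous_parametric_intervalIntegral_of_continuous' h 0 τ
  have hIF_θ : ∀ φ, Continuous fun θ ↦ ∫ σ in (0 : ℝ)..τ, F σ θ φ := fun φ ↦
    hIF.comp (Continuous.prodMk continuous_const continuous_id)
  have hIG_θ : ∀ φ, Continuous fun θ ↦ ∫ σ in (0 : ℝ)..τ, G σ θ φ := fun φ ↦
    hIG.comp (Continuous.prodMk continuous_const continuous_id)
  have hIIF : Continuous fun φ ↦ ∫ θ in (0 : ℝ)..Real.pi, ∫ σ in (0 : ℝ)..τ, F σ θ φ :=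
    intervalIntegral.continuous_parametric_intervalIntegral_of_continuous' hIF 0 Real.pi
  have hIIG : Continuous fun φ ↦ ∫ θ in (0 : ℝ)..Real.pi, ∫ σ in (0 : ℝ)..τ, G σ θ φ :=
    intervalIntegral.continuous_parametric_intervalIntegral_of_continuous' hIG 0 Real.pi
  -- Step A: fundamental theorem of calculus in `σ`
  have hFTC : ∀ θ φ, D τ θ φ - D 0 θ φ =
      c * (∫ σ in (0 : ℝ)..τ, F σ θ φ) + c * (∫ σ in (0 : ℝ)..τ, G σ θ φ) := by
    intro θ φ
    have hderiv : ∀ σ ∈ uIcc (0 : ℝ) τ, HasDerivAt (fun σ' ↦ D σ' θ φ)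
        (c * (F σ θ φ + G σ θ φ)) σ := by
      intro σ hσ
      rw [uIcc_of_le hτ] at hσ
      have h := hD σ θ φ hσ.1
      simp only [hF, hG, max_eq_left hσ.1]
      exact h
    have hint : IntervalIntegrable (fun σ ↦ c * (F σ θ φ + G σ θ φ)) volume 0 τ :=
      (continuous_const.mul ((hF_σ θ φ).add (hG_σ θ φ))).intervalIntegrable 0 τ
    rw [← intervalIntegral.integral_eq_sub_of_hasDerivAt hderiv hint,
      intervalIntegral.integral_const_mul, intervalIntegral.integral_add
        ((hF_σ θ φ).intervalIntegrable 0 τ) ((hG_σ θ φ).intervalIntegrable 0 τ)]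
    ring
  -- Step C: the polar total derivative integrates to zero
  have hGzero : ∀ φ, ∫ θ in (0 : ℝ)..Real.pi, ∫ σ in (0 : ℝ)..τ, G σ θ φ = 0 := by
    intro φ
    rw [intervalIntegral_swap_of_continuous (hG_θσ φ) hπ hτ]
    refine intervalIntegral.integral_zero_ae (Eventually.of_forall fun σ hσ ↦ ?_)
    rw [uIoc_of_le hτ] at hσ
    have hσ0 : 0 ≤ σ := hσ.1.le
    have hderiv : ∀ θ ∈ uIcc (0 : ℝ) Real.pi, HasDerivAt (fun θ' ↦ T σ θ' φ) (G σ θ φ) θ := by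
      intro θ _
      simp only [hG, max_eq_left hσ0]
      exact hT σ θ φ hσ0
    rw [intervalIntegral.integral_eq_sub_of_hasDerivAt hderiv ((hG_θ σ φ).intervalIntegrable _ _),
      hTπ, hT0, sub_zero]
  -- Step D: the azimuthal derivative integrates to zero
  have hFzero : ∫ φ in (0 : ℝ)..2 * Real.pi, ∫ θ in (0 : ℝ)..Real.pi, ∫ σ in (0 : ℝ)..τ, F σ θ φ = 0 := by
    rw [intervalIntegral_swap_of_continuous hIF h2π hπ]
    refine intervalIntegral.integral_zero_ae (Eventually.of_forall fun θ _ ↦ ?_)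
    rw [intervalIntegral_swap_of_continuous (hF_φσ θ) h2π hτ]
    refine intervalIntegral.integral_zero_ae (Eventually.of_forall fun σ hσ ↦ ?_)
    rw [uIoc_of_le hτ] at hσ
    have hσ0 : 0 ≤ σ := hσ.1.le
    have hderiv : ∀ φ ∈ uIcc (0 : ℝ) (2 * Real.pi), HasDerivAt (fun φ' ↦ E σ θ φ') (F σ θ φ) φ := by
      intro φ _
      simp only [hF, max_eq_left hσ0]
      exact hE σ θ φ hσ0
    rw [intervalIntegral.integral_eq_sub_of_hasDerivAt hderiv ((hF_φ σ θ).intervalIntegrable _ _),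
      hEper σ θ hσ0, sub_self]
  -- Step B: assemble
  have hDτ : ∀ φ, IntervalIntegrable (fun θ ↦ D τ θ φ) volume 0 Real.pi := fun φ ↦
    ((hDc τ hτ).comp (Continuous.prodMk continuous_id continuous_const)).intervalIntegrable _ _
  have hD0 : ∀ φ, IntervalIntegrable (fun θ ↦ D 0 θ φ) volume 0 Real.pi := fun φ ↦
    ((hDc 0 le_rfl).comp (Continuous.prodMk continuous_id continuous_const)).intervalIntegrable _ _
  have hIDτ : IntervalIntegrable (fun φ ↦ ∫ θ in (0 : ℝ)..Real.pi, D τ θ φ) volume 0 (2 * Real.pi) := by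
    have h : Continuous (Function.uncurry fun φ θ ↦ D τ θ φ) :=
      (hDc τ hτ).comp (Continuous.prodMk continuous_snd continuous_fst)
    exact (intervalIntegral.continuous_parametric_intervalIntegral_of_continuous' h 0 Real.pi).intervalIntegrable _ _
  have hID0 : IntervalIntegrable (fun φ ↦ ∫ θ in (0 : ℝ)..Real.pi, D 0 θ φ) volume 0 (2 * Real.pi) := by
    have h : Continuous (Function.uncurry fun φ θ ↦ D 0 θ φ) :=
      (hDc 0 le_rfl).comp (Continuous.prodMk continuous_snd continuous_fst)
    exact (intervalIntegral.continuous_parametric_intervalIntegral_of_continuous' h 0 Real.pi).intervalIntegrable _ _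
  rw [← sub_eq_zero, ← intervalIntegral.integral_sub hIDτ hID0]
  have hinner : ∀ φ, (∫ θ in (0 : ℝ)..Real.pi, D τ θ φ) - ∫ θ in (0 : ℝ)..Real.pi, D 0 θ φ =
      c * ∫ θ in (0 : ℝ)..Real.pi, ∫ σ in (0 : ℝ)..τ, F σ θ φ := by
    intro φ
    rw [← intervalIntegral.integral_sub (hDτ φ) (hD0 φ)]
    simp only [hFTC]
    have i1 : IntervalIntegrable (fun θ ↦ c * ∫ σ in (0 : ℝ)..τ, F σ θ φ) volume 0 Real.pi :=
      (continuous_const.mul (hIF_θ φ)).intervalIntegrable _ _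
    have i2 : IntervalIntegrable (fun θ ↦ c * ∫ σ in (0 : ℝ)..τ, G σ θ φ) volume 0 Real.pi :=
      (continuous_const.mul (hIG_θ φ)).intervalIntegrable _ _
    rw [intervalIntegral.integral_add i1 i2,
      intervalIntegral.integral_const_mul, intervalIntegral.integral_const_mul, hGzero φ, mul_zero,
      add_zero]
  simp only [hinner, intervalIntegral.integral_const_mul, hFzero, mul_zero]

/-! ### The derivative expressions as functions and their continuity -/

/-- The `φ`-derivative of the azimuthal flux as a function of `(σ, θ, φ)` (the expression of
`hasDerivAt_phiFlux_phi`). [folklore] -/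
def phiFluxDeriv (M : ℝ) (Ψ : E4 → ℝ) (σ θ φ : ℝ) : ℝ :=
  2 * M * Real.sin θ *
      (fderiv ℝ (fderiv ℝ Ψ) (horizonPoint M σ θ φ) (Real.sin θ • phiHatVec M φ) (E4.basisVector 0) +
        (fderiv ℝ (fderiv ℝ Ψ) (horizonPoint M σ θ φ) (Real.sin θ • phiHatVec M φ) (horizonNull θ φ) +
          fderiv ℝ Ψ (horizonPoint M σ θ φ) (dPhiHorizonNull θ φ))) +
    (fderiv ℝ (fderiv ℝ Ψ) (horizonPoint M σ θ φ) (Real.sin θ • phiHatVec M φ) (phiHatVec M φ) +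
      fderiv ℝ Ψ (horizonPoint M σ θ φ) (dPhiHatVec M φ))

/-- The `θ`-derivative of the polar flux as a function of `(σ, θ, φ)` (the expression of
`hasDerivAt_thetaFlux_theta`). [folklore] -/
def thetaFluxDeriv (M : ℝ) (Ψ : E4 → ℝ) (σ θ φ : ℝ) : ℝ :=
  Real.cos θ * fderiv ℝ Ψ (horizonPoint M σ θ φ) (thetaVec M θ φ) +
    Real.sin θ * (fderiv ℝ (fderiv ℝ Ψ) (horizonPoint M σ θ φ) (thetaVec M θ φ) (thetaVec M θ φ) +
      fderiv ℝ Ψ (horizonPoint M σ θ φ) (dThetaVec M θ φ))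

/-- The clamped horizon-point map `(σ, θ, φ) ↦ p_{max(σ,0)}(θ, φ)` is continuous. [folklore] -/
theorem continuous_horizonPoint_clamp (M : ℝ) :
    Continuous fun q : ℝ × ℝ × ℝ ↦ horizonPoint M (max q.1 0) q.2.1 q.2.2 := by
  simp only [horizonPoint_eq_toLp]
  refine continuous_toLp_four ?_ ?_ ?_ ?_ <;> fun_prop

/-- For fixed `σ` the horizon-point map `(θ, φ) ↦ p_σ(θ, φ)` is continuous. [folklore] -/
theorem continuous_horizonPoint_angles (M σ : ℝ) :
    Continuous fun q : ℝ × ℝ ↦ horizonPoint M σ q.1 q.2 := by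
  simp only [horizonPoint_eq_toLp]
  refine continuous_toLp_four ?_ ?_ ?_ ?_ <;> fun_prop

section Continuity

variable {M : ℝ} {Ψ : E4 → ℝ} {V : Set E4}

/-- **Joint continuity of the clamped `φ`-flux derivative** when `DΨ`, `D²Ψ` are continuous on an
open set containing the horizon points with `σ ≥ 0`. [folklore] -/
theorem continuous_phiFluxDeriv_clamp (hL : ContinuousOn (fderiv ℝ Ψ) V)
    (hB : ContinuousOn (fderiv ℝ (fderiv ℝ Ψ)) V)
    (hPV : ∀ σ θ φ, 0 ≤ σ → horizonPoint M σ θ φ ∈ V) :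
    Continuous fun q : ℝ × ℝ × ℝ ↦ phiFluxDeriv M Ψ (max q.1 0) q.2.1 q.2.2 := by
  have hP := continuous_horizonPoint_clamp M
  have hPV' : ∀ q : ℝ × ℝ × ℝ, horizonPoint M (max q.1 0) q.2.1 q.2.2 ∈ V :=
    fun q ↦ hPV _ _ _ (le_max_right _ _)
  have hLq : Continuous fun q : ℝ × ℝ × ℝ ↦ fderiv ℝ Ψ (horizonPoint M (max q.1 0) q.2.1 q.2.2) :=
    hL.comp_continuous hP hPV'
  have hBq : Continuous fun q : ℝ × ℝ × ℝ ↦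
      fderiv ℝ (fderiv ℝ Ψ) (horizonPoint M (max q.1 0) q.2.1 q.2.2) := hB.comp_continuous hP hPV'
  have hΦ' : Continuous fun q : ℝ × ℝ × ℝ ↦ phiHatVec M q.2.2 := by
    simp only [phiHatVec]
    refine continuous_toLp_four ?_ ?_ ?_ ?_ <;> fun_prop
  have hΦ : Continuous fun q : ℝ × ℝ × ℝ ↦ Real.sin q.2.1 • phiHatVec M q.2.2 :=
    (Real.continuous_sin.comp (continuous_fst.comp continuous_snd)).smul hΦ'
  have hdΦ : Continuous fun q : ℝ × ℝ × ℝ ↦ dPhiHatVec M q.2.2 := by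
    simp only [dPhiHatVec]
    refine continuous_toLp_four ?_ ?_ ?_ ?_ <;> fun_prop
  have hN : Continuous fun q : ℝ × ℝ × ℝ ↦ horizonNull q.2.1 q.2.2 := by
    simp only [horizonNull]
    refine continuous_toLp_four ?_ ?_ ?_ ?_ <;> fun_prop
  have hdN : Continuous fun q : ℝ × ℝ × ℝ ↦ dPhiHorizonNull q.2.1 q.2.2 := by
    simp only [dPhiHorizonNull]
    refine continuous_toLp_four ?_ ?_ ?_ ?_ <;> fun_prop
  simp only [phiFluxDeriv]
  exact ((by fun_prop : Continuous fun q : ℝ × ℝ × ℝ ↦ 2 * M * Real.sin q.2.1).mul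
    (((hBq.clm_apply hΦ).clm_apply continuous_const).add
      (((hBq.clm_apply hΦ).clm_apply hN).add (hLq.clm_apply hdN)))).add
    (((hBq.clm_apply hΦ).clm_apply hΦ').add (hLq.clm_apply hdΦ))

/-- **Joint continuity of the clamped `θ`-flux derivative.** [folklore] -/
theorem continuous_thetaFluxDeriv_clamp (hL : ContinuousOn (fderiv ℝ Ψ) V)
    (hB : ContinuousOn (fderiv ℝ (fderiv ℝ Ψ)) V)
    (hPV : ∀ σ θ φ, 0 ≤ σ → horizonPoint M σ θ φ ∈ V) :
    Continuous fun q : ℝ × ℝ × ℝ ↦ thetaFluxDeriv M Ψ (max q.1 0) q.2.1 q.2.2 := by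
  have hP := continuous_horizonPoint_clamp M
  have hPV' : ∀ q : ℝ × ℝ × ℝ, horizonPoint M (max q.1 0) q.2.1 q.2.2 ∈ V :=
    fun q ↦ hPV _ _ _ (le_max_right _ _)
  have hLq : Continuous fun q : ℝ × ℝ × ℝ ↦ fderiv ℝ Ψ (horizonPoint M (max q.1 0) q.2.1 q.2.2) :=
    hL.comp_continuous hP hPV'
  have hBq : Continuous fun q : ℝ × ℝ × ℝ ↦
      fderiv ℝ (fderiv ℝ Ψ) (horizonPoint M (max q.1 0) q.2.1 q.2.2) := hB.comp_continuous hP hPV'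
  have hΘ : Continuous fun q : ℝ × ℝ × ℝ ↦ thetaVec M q.2.1 q.2.2 := by
    simp only [thetaVec]
    refine continuous_toLp_four ?_ ?_ ?_ ?_ <;> fun_prop
  have hdΘ : Continuous fun q : ℝ × ℝ × ℝ ↦ dThetaVec M q.2.1 q.2.2 := by
    simp only [dThetaVec]
    refine continuous_toLp_four ?_ ?_ ?_ ?_ <;> fun_prop
  simp only [thetaFluxDeriv]
  exact ((by fun_prop : Continuous fun q : ℝ × ℝ × ℝ ↦ Real.cos q.2.1).mul (hLq.clm_apply hΘ)).add
    ((by fun_prop : Continuous fun q : ℝ × ℝ × ℝ ↦ Real.sin q.2.1).mul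
      (((hBq.clm_apply hΘ).clm_apply hΘ).add (hLq.clm_apply hdΘ)))

/-- **Continuity of the density on each sphere `S_σ`, `σ ≥ 0`.** [folklore] -/
theorem continuous_densityFun_angles (hM : 0 < M) (hΨ : ContinuousOn Ψ V)
    (hL : ContinuousOn (fderiv ℝ Ψ) V) (hPV : ∀ σ θ φ, 0 ≤ σ → horizonPoint M σ θ φ ∈ V)
    {σ : ℝ} (hσ : 0 ≤ σ) :
    Continuous fun q : ℝ × ℝ ↦ densityFun M Ψ σ q.1 q.2 := by
  have hP := continuous_horizonPoint_angles M σ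
  have hPV' : ∀ q : ℝ × ℝ, horizonPoint M σ q.1 q.2 ∈ V := fun q ↦ hPV _ _ _ hσ
  have hΨq : Continuous fun q : ℝ × ℝ ↦ Ψ (horizonPoint M σ q.1 q.2) := hΨ.comp_continuous hP hPV'
  have hLq : Continuous fun q : ℝ × ℝ ↦ fderiv ℝ Ψ (horizonPoint M σ q.1 q.2) :=
    hL.comp_continuous hP hPV'
  have hN : Continuous fun q : ℝ × ℝ ↦ horizonNull q.1 q.2 := by
    simp only [horizonNull]
    refine continuous_toLp_four ?_ ?_ ?_ ?_ <;> fun_prop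
  have hfun : (fun q : ℝ × ℝ ↦ densityFun M Ψ σ q.1 q.2) = fun q ↦
      (M * Real.sin q.1 ^ 2 * fderiv ℝ Ψ (horizonPoint M σ q.1 q.2) (E4.basisVector 0) +
        4 * M * fderiv ℝ Ψ (horizonPoint M σ q.1 q.2) (horizonNull q.1 q.2) +
        2 * Ψ (horizonPoint M σ q.1 q.2)) * (2 * M ^ 2 * Real.sin q.1) := by
    funext q
    rw [densityFun, nullVector_horizonPoint hM]
  rw [hfun]
  exact ((((by fun_prop : Continuous fun q : ℝ × ℝ ↦ M * Real.sin q.1 ^ 2).mul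
    (hLq.clm_apply continuous_const)).add (continuous_const.mul (hLq.clm_apply hN))).add
    (continuous_const.mul hΨq)).mul (by fun_prop)

end Continuity

end Literature.Barriers.FinalStateConjecture.Kerr

namespace Literature.Barriers.FinalStateConjecture

open Literature.Geometry.Lorentzian

/-! ### The charge on `S_τ` as the initial charge of the time-translated function -/

/-- The representative of `ψ ∘ φ_s` is the translate of the representative of `ψ`, as functions on
all of `E4` (off the chart both vanish, the chart being invariant under `t*`-translations).
[folklore] -/
theorem Kerr.extend_comp_timeTranslate {a r₀ : ℝ} (ψ : Kerr.region a r₀ → ℝ) (s : ℝ) :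
    Function.extend Subtype.val (ψ ∘ Kerr.timeTranslate a r₀ s) 0 =
      fun z : E4 ↦ Function.extend Subtype.val ψ 0 (z + s • E4.basisVector 0) := by
  funext z
  by_cases hz : z ∈ Kerr.region a r₀
  · have h1 := Kerr.comp_timeTranslate_apply ψ s ⟨z, hz⟩
    have h2 := Kerr.extend_apply_coe (ψ ∘ Kerr.timeTranslate a r₀ s) ⟨z, hz⟩
    simp only at h1 h2
    rw [← h2, h1]
  · have hz' : z + s • E4.basisVector 0 ∉ Kerr.region a r₀ := by
      rwa [Kerr.mem_region, Kerr.radius_add_smul_basisVector_zero, ← Kerr.mem_region]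
    rw [Function.extend_apply' _ _ _ fun ⟨y, hy⟩ ↦ hz (hy ▸ y.2),
      Function.extend_apply' _ _ _ fun ⟨y, hy⟩ ↦ hz' (hy ▸ y.2)]
    rfl

/-- **The charge on `S_τ` is the initial charge of the time-translated function**:
`H₀[ψ](τ) = H₀[ψ ∘ φ_τ](0)`, `φ_τ` the stationary flow `Kerr.timeTranslate` (the density at
`p₀ + τ∂_{t*}` of `ψ` is the density at `p₀` of `ψ ∘ φ_τ`: `D(Ψ ∘ (· + τ∂_{t*}))(p₀) = DΨ(p₀ + τ∂_{t*})`
and `ℓ♯` is `t*`-independent). This is the form in which the conservation law combines with the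
time-translated solutions of `AretakisInstability.of_facts`. [cite: Aretakis2015, §2.2 and §5.2] -/
theorem aretakisChargeAt_eq_aretakisCharge_comp_timeTranslate (M r₀ : ℝ)
    (ψ : Kerr.region M r₀ → ℝ) (τ : ℝ) :
    aretakisChargeAt M r₀ ψ τ = aretakisCharge M r₀ (ψ ∘ Kerr.timeTranslate M r₀ τ) := by
  unfold aretakisChargeAt aretakisCharge
  refine intervalIntegral.integral_congr fun φ _ ↦ intervalIntegral.integral_congr fun θ _ ↦ ?_
  simp only [aretakisChargeDensityAt, aretakisChargeDensity, Kerr.extend_comp_timeTranslate ψ τ,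
    fderiv_comp_add_right, Kerr.nullVector_add_smul_basisVector_zero]

/-- Under the conservation law, the initial charge is invariant under the stationary flow for
solutions: `H₀[ψ ∘ φ_τ] = H₀[ψ]` for `τ ≥ 0` (unpacking with the bridge). [cite: Aretakis2015, Prop. 5.1] -/
theorem Aretakis2015_chargeConservation.charge_comp_timeTranslate (h : Aretakis2015_chargeConservation)
    [Kerr.Facts] [Kerr.SliceFacts] {M : ℝ} (hM : 0 < M) {r₀ : ℝ} (hr₀ : r₀ ∈ Set.Ioo 0 M)
    {U : Set (Kerr.region M r₀)} {ψ : Kerr.region M r₀ → ℝ} (hU : IsOpen U)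
    (hKU : {x : Kerr.region M r₀ | Kerr.rPlus M M ≤ Kerr.radius M (x : E4) ∧ 0 ≤ (x : E4) 0} ⊆ U)
    (hψ : ContMDiffOn 𝓘(ℝ, E4) 𝓘(ℝ, ℝ) ∞ ψ U)
    (hsol : ∀ x ∈ U, (Kerr.smoothMetric M M r₀).toPseudoRiemannianMetric.dalembertian ψ x = 0)
    {τ : ℝ} (hτ : 0 ≤ τ) :
    aretakisCharge M r₀ (ψ ∘ Kerr.timeTranslate M r₀ τ) = aretakisCharge M r₀ ψ := by
  rw [← aretakisChargeAt_eq_aretakisCharge_comp_timeTranslate]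
  exact h M hM r₀ hr₀ U ψ hU hKU hψ hsol τ hτ

/-! ### The conservation law -/

/-- **Aretakis's conservation law on the extremal Kerr horizon (discharge of the named fact
`Aretakis2015_chargeConservation`).** For every `ψ` of class `C^∞` on an open set
`U ⊇ {r ≥ M} ∩ {t* ≥ 0}` of the extremal Kerr–Schild chart with `□_{g_{M,M}} ψ = 0` on `U`, the
charge `H₀^{Kerr}[ψ](τ) = ∫_{S_τ} (M sin² θ · Tψ + 4M · Yψ + 2ψ)` on the horizon sphere `S_τ`,
`τ ≥ 0`, equals its value on `S₀`. Proof: the `σ`-derivative of the density is, by the wave equation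
restricted to the horizon (`Kerr.horizon_density_deriv_identity`, using `g^{rr} = 0` at `r = M` and
`∑ ∂_μ g^{μν} = −(2M/Σ)ℓ^ν`), `−2M` times the sum of the `φ`-derivative of the `2π`-periodic flux
`2M sin θ (Tψ + Yψ) + Φ̂ψ` and the `θ`-derivative of the flux `sin θ · Θψ` vanishing at the poles;
integrate (`Kerr.sphereIntegral_eq_of_hasDerivAt`). Aretakis, ATMP 19 (2015), §5.2 ("is conserved
along `𝓗`") and Prop. 5.1, `l = 0`; mechanism Prop. 3.1. [cite: Aretakis2015, §5.2 and Prop. 5.1 (l = 0); Prop. 3.1] -/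
theorem Aretakis2015_chargeConservation_holds : Aretakis2015_chargeConservation := by
  intro _ _ M hM r₀ hr₀ U ψ hU hKU hψ hsol τ hτ
  obtain ⟨hr₀pos, hr₀M⟩ := hr₀
  -- the representative and the open set of `E4` on which it is smooth
  set Ψ : E4 → ℝ := Function.extend Subtype.val ψ 0 with hΨdef
  have hrep : ∀ y : Kerr.region M r₀, ψ y = Ψ y := Kerr.extend_apply_coe ψ
  set V : Set E4 := Subtype.val '' U with hVdef
  have hV : IsOpen V := (Kerr.region M r₀).isOpen.isOpenMap_subtype_val U hU
  have hΨV : ∀ x ∈ V, ContDiffAt ℝ 2 Ψ x := by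
    rintro x ⟨y, hyU, rfl⟩
    have h := (OpensChart.contMDiffAt_iff y ψ Ψ hrep).mp (hψ.contMDiffAt (hU.mem_nhds hyU))
    exact h.of_le (WithTop.coe_le_coe.mpr le_top)
  have hΨon : ContDiffOn ℝ 2 Ψ V := fun x hx ↦ (hΨV x hx).contDiffWithinAt
  have hΨc : ContinuousOn Ψ V := hΨon.continuousOn
  have hLc : ContinuousOn (fderiv ℝ Ψ) V := hΨon.continuousOn_fderiv_of_isOpen hV (by norm_num)
  have hBc : ContinuousOn (fderiv ℝ (fderiv ℝ Ψ)) V :=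
    (hΨon.fderiv_of_isOpen hV (m := 1) le_rfl).continuousOn_fderiv_of_isOpen hV le_rfl
  -- horizon points with `σ ≥ 0` lie in `U`
  have hmem : ∀ σ θ φ, 0 ≤ σ → ∃ hp : Kerr.horizonPoint M σ θ φ ∈ Kerr.region M r₀,
      (⟨_, hp⟩ : Kerr.region M r₀) ∈ U := by
    intro σ θ φ hσ
    refine ⟨Kerr.horizonPoint_mem_region hM hr₀M σ θ φ, hKU ⟨?_, ?_⟩⟩
    · show Kerr.rPlus M M ≤ Kerr.radius M (Kerr.horizonPoint M σ θ φ)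
      rw [Kerr.rPlus_self, Kerr.radius_horizonPoint hM.le]
    · show 0 ≤ Kerr.horizonPoint M σ θ φ 0
      rw [Kerr.horizonPoint_apply_zero]
      exact hσ
  have hPV : ∀ σ θ φ, 0 ≤ σ → Kerr.horizonPoint M σ θ φ ∈ V := by
    intro σ θ φ hσ
    obtain ⟨hp, hpU⟩ := hmem σ θ φ hσ
    exact ⟨_, hpU, rfl⟩
  have hΨ2 : ∀ σ θ φ, 0 ≤ σ → ContDiffAt ℝ 2 Ψ (Kerr.horizonPoint M σ θ φ) :=
    fun σ θ φ hσ ↦ hΨV _ (hPV σ θ φ hσ)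
  -- the wave equation at the horizon points, in coordinates
  have hwave : ∀ σ θ φ, 0 ≤ σ →
      ∑ μ, ∑ ν, Kerr.inverseMetric M M (Kerr.horizonPoint M σ θ φ) μ ν *
          fderiv ℝ (fderiv ℝ Ψ) (Kerr.horizonPoint M σ θ φ) (E4.basisVector μ) (E4.basisVector ν) +
        ∑ ν, Kerr.divInverseMetric M M (Kerr.horizonPoint M σ θ φ) ν *
          fderiv ℝ Ψ (Kerr.horizonPoint M σ θ φ) (E4.basisVector ν) = 0 := by
    intro σ θ φ hσ
    obtain ⟨hp, hpU⟩ := hmem σ θ φ hσ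
    have h := hsol _ hpU
    rwa [Kerr.dalembertian_eq_hessian_add_firstOrder M M r₀ hrep ⟨_, hp⟩ (hΨ2 σ θ φ hσ)] at h
  -- reduce to the abstract sphere lemma
  show aretakisChargeAt M r₀ ψ τ = aretakisCharge M r₀ ψ
  rw [← aretakisChargeAt_zero]
  unfold aretakisChargeAt
  simp only [Kerr.aretakisChargeDensityAt_eq_densityFun]
  refine Kerr.sphereIntegral_eq_of_hasDerivAt (D := fun σ θ φ ↦ Kerr.densityFun M Ψ σ θ φ)
    (E := fun σ θ φ ↦ Kerr.phiFlux M Ψ σ θ φ) (T := fun σ θ φ ↦ Kerr.thetaFlux M Ψ σ θ φ)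
    (dE := fun σ θ φ ↦ Kerr.phiFluxDeriv M Ψ σ θ φ) (dT := fun σ θ φ ↦ Kerr.thetaFluxDeriv M Ψ σ θ φ)
    (c := -(2 * M)) hτ ?_ ?_ ?_ ?_ ?_ ?_ ?_ ?_ ?_
  · -- `∂_σ` of the density
    intro σ θ φ hσ
    have hd := Kerr.hasDerivAt_densityFun_sigma hM (hΨ2 σ θ φ hσ)
    have hid := Kerr.horizon_density_deriv_identity hM σ θ φ
      (fderiv ℝ (fderiv ℝ Ψ) (Kerr.horizonPoint M σ θ φ))
      ((hΨ2 σ θ φ hσ).isSymmSndFDerivAt (by simp)) (fderiv ℝ Ψ (Kerr.horizonPoint M σ θ φ))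
    rw [hwave σ θ φ hσ, mul_zero, mul_zero] at hid
    refine hd.congr_deriv ?_
    simp only [Kerr.phiFluxDeriv, Kerr.thetaFluxDeriv]
    linear_combination (2 * M) * hid
  · intro σ θ φ hσ
    exact Kerr.hasDerivAt_phiFlux_phi (hΨ2 σ θ φ hσ)
  · intro σ θ hσ
    have h := Kerr.phiFlux_add_two_pi M Ψ σ θ 0
    rw [zero_add] at h
    exact h
  · intro σ θ φ hσ
    exact Kerr.hasDerivAt_thetaFlux_theta (hΨ2 σ θ φ hσ)
  · intro σ φ
    exact Kerr.thetaFlux_zero M Ψ σ φ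
  · intro σ φ
    exact Kerr.thetaFlux_pi M Ψ σ φ
  · exact Kerr.continuous_phiFluxDeriv_clamp hLc hBc hPV
  · exact Kerr.continuous_thetaFluxDeriv_clamp hLc hBc hPV
  · intro σ hσ
    exact Kerr.continuous_densityFun_angles hM hΨc hLc hPV hσ

end Literature.Barriers.FinalStateConjecture

namespace Literature.Barriers.FinalStateConjecture.Kerr

end Literature.Barriers.FinalStateConjecture.Kerr

end
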